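import Summits.BirchSwinnertonDyer.BirchSwinnertonDyer.Theorems.ByReductionTypeAtTwoAdditiveOddBranchFEDoor
import Summits.BirchSwinnertonDyer.BirchSwinnertonDyer.Theorems.ByReductionTypeAtTwoAdditiveSelmerTwistTransportDatum
import Summits.BirchSwinnertonDyer.BirchSwinnertonDyer.Theorems.ByReductionTypeAtTwoAdditiveSelmerTwistDictionary
import HarnessLib

/-!
# Route ByReductionTypeAtTwo, crux C4″ `AdditivePotMultOverKAtTwo` (stmt-BirchSwinnertonDyer-22618) — THE (−2)-BLOCK DOOR
# VIA R15: the (−1)-block PRINT-EXACT door (T20, `hLtι` in the kernel) applied at a model `W₂` of `W^{(2)}` and read at `W`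

Seat `bsd-2adic-t42` GEN 22 (cell `bsd-2adic`). HONEST FRAMING: THEOREMS ONLY; closes no item; nothing booked; conditional on
the (−1)-block typed input `AddKatoTwo.KatoOddBranchInputsAtTwoNegOneSplitTwistPrintExact` (MEMO/conjecture-grade at `2`) and
`Kato2004.thm12_4` exactly like the (−1)-block door it transports; BSD is not proved by any of this.

**`lengthAt_selmerDualContra_le_twist_of_oddBranchInputsPrintExact_fe`.** Let `W/ℚ` be in the (−2)-SPLIT-TWIST block
(`W^{(−2)}` split multiplicative at `2`, `W[2]` irreducible) and let `W₂` be a GLOBALLY MINIMAL `ℚ`-model of `W^{(2)}`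
(`V • W₂ = W^{(2)}`). Then `W₂` is in the (−1)-block with the same newform `f` of `W^{(−2)} ≅ W₂^{(−1)}` and `W₂[2]`
irreducible (file `…Dictionary`), so the (−1)-block PRINT-EXACT door
`MultOddBranchFE.lengthAt_selmerDualContra_le_of_oddBranchInputsPrintExact_fe` applies AT `W₂` to the companion datum `D₂`
of any `D′ : W.SelmerDualData κ γ⁻¹` (file `…TransportDatum`: finite generation and the `ι`-symmetry `hXι` move from
`D′` to `D₂`); reading the conclusion at `W` (file `…TransportDoors`) gives, for every height-one `𝔮 ∌ 2`,

  `ℓ_𝔮(D′.X) ≤ ℓ_𝔮(Λ/(Tw Lt))`,  `ι(Lt) = 2^m · L⁻_2(f, 1, ω)`,  `Tw = unitTwistEquiv (−1)` (`T ↦ −T − 2`).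

So the (−2)-block rows need NO `KatoOddBranchInputsAtTwoNegTwoSplitTwistPrintExact`: their input is the (−1)-block's, at
`W₂`, plus Kato's `𝐇¹`-datum `I₂` of `W₂`; the remaining identification of `(Tw Lt)` with the `ωχ₂`-branch bound
`2^m · L⁻_2(f, 1, ωχ₂)` is the ANALYTIC half of R15 (k4-w3), entering through `…_of_span_eq`.

References: [Kato2004Asterisque] Thm. 12.5 (3), (12.5.1), §17.13; [GreenbergLNM1716] §4 p. 107, Thm. 1.14; [Rubin2000] VI §1–§2;
[MazurTateTeitelbaum1986Invent] §I.17.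
-/

set_option autoImplicit false
-- the summit's namespace `Summit.BirchSwinnertonDyer.BirchSwinnertonDyer` (Sub = Summit) trips `dupNamespace`
set_option linter.dupNamespace false

noncomputable section

open scoped Classical MatrixGroups ModularForm NumberField

open Field CongruenceSubgroup PowerSeries WeierstrassCurve IsDedekindDomain Literature.NumberTheory.EllipticCurves
  Literature.NumberTheory.EllipticCurves.ModularForms Literature.NumberTheory.EllipticCurves.IwasawaAlgebra
  Literature.NumberTheory.EllipticCurves.Module Literature.NumberTheory.EllipticCurves.PadicIntSeries

namespace Summit.BirchSwinnertonDyer.BirchSwinnertonDyer.Theorems.AddSelmerTwistTwo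

/-- **THE (−2)-BLOCK DOOR VIA THE TWIST BY `2`.** For `W` with `W^{(−2)}` split multiplicative at `2` and `W[2]` irreducible,
a globally minimal model `W₂` of `W^{(2)}` (`V • W₂ = W^{(2)}`), `κ` cyclotomic with normalised top generator `γ`, the newform
`f` of `W^{(−2)}`, a Kato `𝐇¹`-datum `I₂` of `W₂`, and every finitely generated `D′ : W.SelmerDualData κ γ⁻¹` with `ι`-symmetric
characteristic ideal: at every height-one `𝔮 ∌ 2`, `ℓ_𝔮(D′.X) ≤ ℓ_𝔮(Λ/(Tw Lt))` where `ι(Lt) = 2^m·L⁻_2(f,1,ω)`, `Lt ≠ 0`,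
`Tw = unitTwistEquiv (−1)`. Conditional on `Kato2004.thm12_4` and the (−1)-block typed input (as the (−1)-block door).
[cite: Kato2004Asterisque, Thm. 12.5 (3) and (12.5.1) (p. 222), §17.13 (pp. 279–280)] [cite: GreenbergLNM1716, §4 p. 107] -/
theorem lengthAt_selmerDualContra_le_twist_of_oddBranchInputsPrintExact_fe (h12 : Kato2004.thm12_4)
    (hPE : AddKatoTwo.KatoOddBranchInputsAtTwoNegOneSplitTwistPrintExact)
    (W W₂ : WeierstrassCurve ℚ) [W₂.IsElliptic] [W₂.IsGloballyMinimal] [ContinuousSMul ℤ_[2] (W₂.tateModule 2)]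
    {V : VariableChange ℚ} (hV : V • W₂ = W.quadraticTwist 2)
    {N : ℕ} [NeZero N] (f : CuspForm (Gamma0 N) 2) (κ : ZpExtension ℚ 2) (γ : absoluteGaloisGroup ℚ)
    (hsp : (W.quadraticTwist (-2)).HasSplitMultiplicativeReductionAtPrime 2)
    (hirr : W.HasIrreducibleModPGaloisRep 2) (hκ : κ.IsCyclotomic) (hγ : κ.IsTopGenerator γ)
    (hγ' : IsCyclotomicVariable 2 γ) (hf : IsNewformOf (W.quadraticTwist (-2)) f)
    (I₂ : Kato2004.IwasawaH1Data W₂ 2 κ γ) (D' : W.SelmerDualData κ γ⁻¹) [Module.Finite (IwasawaAlgebra 2) D'.X]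
    (hXι : (charIdeal (IwasawaAlgebra 2) D'.X).map (IwasawaAlgebra.invol 2).toRingHom =
      charIdeal (IwasawaAlgebra 2) D'.X)
    (Lt : IwasawaAlgebra 2) (m : ℕ)
    (hLt : iwasawaToPowerSeries 2 Lt =
      PowerSeries.C ((2 : ℚ_[2]) ^ m) * padicLFunctionMinusBranchMult f (1 : ℚ_[2]) 1)
    (hLt0 : Lt ≠ 0)
    (𝔮 : PrimeSpectrum (IwasawaAlgebra 2)) (h𝔮 : 𝔮.asIdeal.height = 1)
    (hp𝔮 : PowerSeries.C (2 : ℤ_[2]) ∉ 𝔮.asIdeal) :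
    lengthAt (IwasawaAlgebra 2) D'.X 𝔮 ≤
      lengthAt (IwasawaAlgebra 2)
        (IwasawaAlgebra 2 ⧸ Ideal.span {unitTwistEquiv (-1 : ℤ_[2]ˣ) norm_neg_one_sub_one_lt Lt}) 𝔮 := by
  -- the (−1)-block data at `W₂` (dictionary)
  have hsp₂ : (W₂.quadraticTwist (-1)).HasSplitMultiplicativeReductionAtPrime 2 :=
    (hasSplitMultiplicativeReductionAtPrime_twistNegOne_model_iff W W₂ hV).mpr hsp
  have hirr₂ : W₂.HasIrreducibleModPGaloisRep 2 := hasIrreducibleModPGaloisRep_model W W₂ hV hirr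
  have hf₂ : IsNewformOf (W₂.quadraticTwist (-1)) f := (isNewformOf_twistNegOne_model_iff W W₂ hV f).mpr hf
  -- the companion datum `D₂` of `D'` (key `γ⁻¹`) with its side conditions
  obtain ⟨D₂, hfin, -, -, hXι₂, hdoor⟩ := exists_twist_selmerDualData_two_door κ W W₂ hκ
    (inv_not_mem_layerSubgroup_one_of_isTopGenerator κ hγ) hV D'
  haveI : Module.Finite (IwasawaAlgebra 2) D₂.X := hfin.mpr inferInstance
  -- the (−1)-block door AT `W₂`, for `D₂`, read at `W`
  exact hdoor Lt (fun 𝔮' h𝔮' hp𝔮' ↦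
    MultOddBranchFE.lengthAt_selmerDualContra_le_of_oddBranchInputsPrintExact_fe h12 hPE W₂ f κ γ hsp₂ hirr₂ hκ hγ hγ'
      hf₂ I₂ D₂ (hXι₂ hXι) Lt m hLt hLt0 𝔮' h𝔮' hp𝔮') 𝔮 h𝔮 hp𝔮

/-- **The same with the bound renamed by the analytic half of R15**: if `(Tw Lt) = (L)` as ideals of `Λ` (k4-w3: `Tw` of the
`ω`-branch bound generates the ideal of the `ωχ₂`-branch bound), the conclusion is literally the (−2)-block door's:
`ℓ_𝔮(D′.X) ≤ ℓ_𝔮(Λ/(L))`. [cite: Kato2004Asterisque, Thm. 12.5 (3) and (12.5.1) (p. 222)] [cite: Rubin2000, Ch. VI §1–§2] -/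
theorem lengthAt_selmerDualContra_le_of_oddBranchInputsPrintExact_fe_of_span_eq (h12 : Kato2004.thm12_4)
    (hPE : AddKatoTwo.KatoOddBranchInputsAtTwoNegOneSplitTwistPrintExact)
    (W W₂ : WeierstrassCurve ℚ) [W₂.IsElliptic] [W₂.IsGloballyMinimal] [ContinuousSMul ℤ_[2] (W₂.tateModule 2)]
    {V : VariableChange ℚ} (hV : V • W₂ = W.quadraticTwist 2)
    {N : ℕ} [NeZero N] (f : CuspForm (Gamma0 N) 2) (κ : ZpExtension ℚ 2) (γ : absoluteGaloisGroup ℚ)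
    (hsp : (W.quadraticTwist (-2)).HasSplitMultiplicativeReductionAtPrime 2)
    (hirr : W.HasIrreducibleModPGaloisRep 2) (hκ : κ.IsCyclotomic) (hγ : κ.IsTopGenerator γ)
    (hγ' : IsCyclotomicVariable 2 γ) (hf : IsNewformOf (W.quadraticTwist (-2)) f)
    (I₂ : Kato2004.IwasawaH1Data W₂ 2 κ γ) (D' : W.SelmerDualData κ γ⁻¹) [Module.Finite (IwasawaAlgebra 2) D'.X]
    (hXι : (charIdeal (IwasawaAlgebra 2) D'.X).map (IwasawaAlgebra.invol 2).toRingHom =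
      charIdeal (IwasawaAlgebra 2) D'.X)
    (Lt L : IwasawaAlgebra 2) (m : ℕ)
    (hLt : iwasawaToPowerSeries 2 Lt =
      PowerSeries.C ((2 : ℚ_[2]) ^ m) * padicLFunctionMinusBranchMult f (1 : ℚ_[2]) 1)
    (hLt0 : Lt ≠ 0)
    (hspan : Ideal.span {unitTwistEquiv (-1 : ℤ_[2]ˣ) norm_neg_one_sub_one_lt Lt} = Ideal.span {L})
    (𝔮 : PrimeSpectrum (IwasawaAlgebra 2)) (h𝔮 : 𝔮.asIdeal.height = 1)
    (hp𝔮 : PowerSeries.C (2 : ℤ_[2]) ∉ 𝔮.asIdeal) :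
    lengthAt (IwasawaAlgebra 2) D'.X 𝔮 ≤ lengthAt (IwasawaAlgebra 2) (IwasawaAlgebra 2 ⧸ Ideal.span {L}) 𝔮 := by
  rw [← hspan]
  exact lengthAt_selmerDualContra_le_twist_of_oddBranchInputsPrintExact_fe h12 hPE W W₂ hV f κ γ hsp hirr hκ hγ hγ' hf
    I₂ D' hXι Lt m hLt hLt0 𝔮 h𝔮 hp𝔮

end Summit.BirchSwinnertonDyer.BirchSwinnertonDyer.Theorems.AddSelmerTwistTwo

end
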